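import Literature.MathematicalPhysics.QuantumFieldTheory.Balaban1983to89.Node00.OpsYRead342
import Literature.MathematicalPhysics.QuantumFieldTheory.Balaban1983to89.Node00.MemberYRefine
import Literature.MathematicalPhysics.QuantumFieldTheory.Balaban1983to89.T4EtaRate

/-!
# NODE 00 — the TWO-MEMBER (3.42) difference reader `kernelFamilyS₂` («run A at η, run B at η′ = L^{−n}η»), King's pairing of a member with its refinement

[B9] = Bałaban, *Propagators for lattice gauge theories in a background field*, CMP 99 (1985) 389–434; [K] = King, *The U(1) Higgs model. I. The continuum
limit*, CMP 102 (1986) 649–677 (the η-rate convention p.664 and Prop. 3.9 (3.73) p.665, as typed in `T4EtaRate`); [4] = Bałaban, *Propagators and renormalization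
transformations II*, CMP 96 (1984) 223–250.  REVISION v1.1 (doc-only, zero decl change): header prose [K] = King I (CMP 102, 649–677), as in `Node00.MemberYRefine` v1.0.1.

THE OBJECT (dag-n15-a's LOCATED-R (R-ii), fleet bus l.26386; trigger (t5) l.35176; GO l.35782).  N15's η-rate statements (`T4EtaRate.NE2PlusOperator`) quantify
over a `T4EtaRate.PairedInstance` (coarse geometry `gc`, fine geometry `gf`, an `EtaPairing`) and a `B9.KernelFamily gc Bf` «whose entries are evaluated at a
fine configuration U′, a coarse test function λ (transported by τ) and a coarse observation site y (embedded by ι) — e.g. entry n = 0 is INTENDED to be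
sup_{x′ ∈ Δ(ι y)} |(G^{η′}(U′) τλ)(x′) − (G^{η}(avg U′) λ)(x)| with x′ ∈ Bⁿ(x)» ([K] p.664 «When x′ ∈ T_{η′}, we denote by x that point in T_η for which
x′ ∈ Bⁿ(x)»).  MODULE A of this seat's g19 (`Node00.MemberYRefineDomains` ∕ `Node00.MemberYRefine`, (R-i)) typed the n-fold refinement `refineK ∕ refineY`,
the coarsening `coarsen` («x′ ↦ x»), the index-bond embedding `idxUp ∕ ιY` and the candidate argument transport `τPull`.  THIS FILE types (R-ii) over them
for def-Y's genuine (3.42) letters `cdS ∕ cdsS ∕ lapS ∕ liftY ∕ supBlkS′ ∕ etaS` of `Node00.OpsYOfLetters` (the letters of the single-member reader `kernelFamilyS`):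
* §1 the pair's carriers at an index `i` and its refinement `i⁺ = refineK i n`: `coarsenY i n : SiteY i⁺ → SiteY i`, `ιK i n : IBondY i → IBondY i⁺` (`= idxUp`;
  `ιY x n = ιK x.toKIdx n`), `beta_ιK` (`Δ⁺(ι y) = ιB Δ(y)`) and `blkOf_coarsenY` (`x′ ∈ ιB Δ ⟹ x ∈ Δ`);
* §2 the pointwise letter vector `eValS j O U Λ m μ z` (`m = 0…3`: `(OΛ)(z), (∇_{U,μ}OΛ)(z), (O∇*_{U,μ}Λ)(z), (Δ_U OΛ)(z)`), the DIFFERENCE ENTRIES `eDiffS` =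
  `sup_{x′ ∈ Δ′, μ} ‖η′^{e_m}·eValS⁺(x′) − η^{e_m}·eValS(coarsen x′)‖`, `e = (2,1,1,0)` (the η-powers of `kernelFamilyS`, INSIDE the difference — the two members
  have different spacings; the FINE point is read against ITS OWN coarsening, no chosen representative), and ★ `kernelFamilyS₂ i n B cfgf cfgc Of Oc :
  B9.KernelFamily (geo9K i) B` — FINE backgrounds `B`, run B's configuration `cfgf : B.Cfg → CfgY 𝔸 i⁺`, run A's `cfgc : B.Cfg → CfgY 𝔸 i` (at the record the
  n-fold average — A PARAMETER here), site letters `Of ∕ Oc` (record default `GpY _ (parSymY _)` at both members, `OpsYOfLetters.operatorLayerYOfLetters_Gp`);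
  `e m U′ (.inl f) y = ⨆_{‖E‖ ≤ 1} eDiffS … ((f∘coarsen) ⊗ E) (f ⊗ E) Δ⁺(ιK y) m`, `.inr ↦ 0`, `h1 ∕ e4 ∕ h2 ∕ l2 ∕ glob := 0` (`T4EtaRate` header (4): no η-rate
  shape for (3.43)–(3.47); `EtaRateIneq342` reads `Kd.e` only); READ: `eValS_bound_of_eBlock` (def-Y's four READ lemmas of `Node00.OpsYRead342` as ONE
  letter-vector bound) and ★ `eDiffS_le_of_pointwise(_beta)` — the triangle inequality: pointwise bounds `M₁ m` on `Δ⁺ = ιB Δ` and `M₂ m` on `Δ` give `≤ M₁ m + M₂ m`;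
* §3 AT A MEMBER OF RECORD `x`, `x⁺ = refineY x n`: ★ `pairingY x n avg havg : T4EtaRate.EtaPairing (geo9Y x) (geo9Y x⁺) (bg9Y 𝔸 G x) (bg9Y 𝔸 G x⁺)` — MODULE A's
  fields BY NAME (`ι := ιY, scale_ι := scale_ιY, dist_ι := dist_ιY, τ := τPull, suppIn_τ := suppIn_τPull, supNorm_τ := supNorm_τPull_le, eta_eq := eta_refineY …`),
  the background transport `avg` with `avg 1 = 1` a PARAMETER; `pairedInstanceY`; ★ `kernelFamilyS₂Y x n avg Of Oc : B9.KernelFamily (geo9Y x) (bg9Y 𝔸 G x⁺)`;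
  ★★ `eBlock_kernelFamilyS₂Y_of_eBlock` (the ONE read face): (3.42) with `(B₁, δ)` for the fine letter at `U′` AND (3.42) with `(B₂, δ)` for the coarse letter at
  `avg U′` ⟹ `EBlock … (B₁ + B₂) δ U′` for the pair reader = (`etaRateIneq342_zero_iff`) N15's `EtaRateIneq342` AT RATE EXPONENT `γ = 0` — [B9] Thm 3.1 twice and
  the triangle inequality; the η-GAIN `γ > 0` ([K] Prop. 3.9 (3.73)) is N15's content and is NOT asserted here.
HONEST SCOPE.  OBJECTS and sup ∕ triangle-inequality bookkeeping over def-Y's definitions; η-DIFFERENCE statements are NOT PRINTED in [B9] (`T4EtaRate` GAPS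
G-t4-U1a-1 ∕ 2: the transports `ι, τ, avg` are unprinted conventions typed as DATA; [K] p.664 prints the point convention only); Bałaban's n-fold average
`avg` is NOT constructed (a parameter; RR-1 ∕ dag-n15-a's `pairingOfRecord₁₁` datum); nothing of [B9] Thm 3.1 ∕ 3.14 or of NE2⁺ asserted; the READ face carries
`Node00.OpsYRead342`'s real-basis hypotheses (`b`, `hrepr`) verbatim; COUNT-NEUTRAL; N15 ∕ N06 NOT discharged; one finite 𝕋⁴ programme at fixed ε — nothing
continuum, nothing about the mass gap.  Cell `pub-ymgap` (HUMAN RULING D-0062), Track A nodes N06 [B9] ∕ N15, seat `pub-ymgap-node00-def-Y` (g21), 2026-08-28.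
-/

namespace Literature.MathematicalPhysics.QuantumFieldTheory.Balaban1983to89.Node00.OpsYRead342Pair

open B4Reflection242 (boxDom)
open B6MultiLevelBoxOperator (N0)
open B6Geom246MultiLevelBox (bset blkOf)
open B6Ineq2142KLevelV1 (β)
open B6KLevelCensusIndexV1 (KIdx)
open B6Prop22KLevelCensusEta (epow)
open B9FromB6 (EBlock)
open B9GeoNormsKLevelV1 (geo9K geo9K_supNorm_nonneg)
open B9Ineq347AllEntries (pref4_nonneg)
open B9Ineq349SiteReading (supBlkS'_nonneg)
open B9Ineq349SiteComposite (supBlkS'_le etaS_pos)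
open B9PinMembersKLevelV1 (MemberY geo9Y bg9Y)
open B6GlobalChartV1 (PV)
open Node00.OpsYRead342 (norm_le_supBlkS' sq_eta_mul_norm_le_of_eBlock eta_mul_norm_cdS_le_of_eBlock eta_mul_norm_cdsS_le_of_eBlock
  norm_lapS_le_of_eBlock)
open Node00.MemberYRefineDomains (coarsen refineT ιB ιB_injective blkOf_refine)
open Node00.MemberYRefine (hN_refine hk_refine idxUp beta_idxUp refineK refineY ιY τPull scale_ιY dist_ιY len_ιY k_refineY L_refineY M_refineY
  eta_refineY suppIn_τPull supNorm_τPull_le)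
open T4EtaRate (EtaPairing PairedInstance EtaRateIneq342 rateFactor)

noncomputable section

variable {d ℓ : ℕ} {hd : 1 ≤ d + 1} {hL : Odd (ℓ + 1) ∧ 1 < ℓ + 1} {b₀ b₁ : ℝ} {Mstar : ℕ}
variable {𝔸 : Type} [NormedRing 𝔸] [NormedAlgebra ℂ 𝔸] [CompleteSpace 𝔸]

/-! ## §1 The pair's carriers at an index and its `n`-fold refinement: `x′ ↦ x`, `y ↦ ι y`, and the block bookkeeping -/

section Carriers

variable (i : KIdx d ℓ hd hL b₀ b₁) (n : ℕ)

/-- **THE COARSENING OF FINE TORUS SITES** `x′ ↦ x` («x′ ∈ Bⁿ(x)») between the refined member `i⁺ = refineK i n` and `i` — MODULE A's `coarsen` at def-Y's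
site carrier `SiteY`. [cite: King1986, p.664 («we denote by x that point in T_η for which x′ ∈ Bⁿ(x)»)] -/
def coarsenY : SiteY (refineK i n) → SiteY i := fun z => coarsen (ℓ := ℓ) (Mh := i.Mh) (k := i.k) (P := i.P') n z

/-- **THE EMBEDDING OF COARSE OBSERVATION SITES** `y ↦ ι y` (index bonds `𝔅 → 𝔅⁺`, level `j ↦ j + n`) — MODULE A's `idxUp`; at a member `ιY x n = ιK x.toKIdx n`.
[cite: King1986, p.664 («a site of Λ_j in run A ↦ the site of scale index j + n … in run B»)] -/
def ιK : IBondY i → IBondY (refineK i n) := idxUp i.hN i.D i.hk n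

/-- at a member of record, MODULE A's `ιY` IS `ιK`. [cite: King1986, p.664, dictionary] -/
theorem ιY_eq_ιK (x : MemberY d ℓ hd hL b₀ b₁ Mstar) (c : (geo9Y x).Site) : ιY x n c = ιK x.toKIdx n c := rfl

/-- **`Δ⁺(ι y) = ιB Δ(y)`**: the carrier block of the embedded site is the refined copy of the carrier block (V1 indices have `k ≥ 2 ≥ 1`).
[cite: Balaban1984PropagatorsII, (2.45) p.231; King1986, p.664] -/
theorem beta_ιK (c : IBondY i) :
    β (refineK i n).hN (refineK i n).D (refineK i n).hk (ιK i n c) = ιB i.D n (β i.hN i.D i.hk c) :=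
  beta_idxUp i.hN i.D i.hk n (le_trans one_le_two i.hk2) c

/-- **`x′ ∈ ιB Δ ⟹ x ∈ Δ`**: a fine site of the refined copy of a block coarsens into the block. [cite: Balaban1984PropagatorsII, (2.45) p.231; King1986, p.664] -/
theorem blkOf_coarsenY {s : BlkY i} {z : SiteY (refineK i n)} (hz : blkOf (refineK i n).D.toDomains z = ιB i.D n s) :
    blkOf i.D.toDomains (coarsenY i n z) = s := by
  apply ιB_injective i.D n
  have h := blkOf_refine i.D n z
  exact h ▸ hz

/-- the fine block of a coarse-block site: `x′ ∈ Δ⁺(ι y)` iff-free reading used below — `x′ ∈ Δ⁺(ι y) ⟹ x ∈ Δ(y)`. [cite: King1986, p.664, bookkeeping] -/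
theorem blkOf_coarsenY_of_beta {c : IBondY i} {z : SiteY (refineK i n)}
    (hz : blkOf (refineK i n).D.toDomains z = β (refineK i n).hN (refineK i n).D (refineK i n).hk (ιK i n c)) :
    blkOf i.D.toDomains (coarsenY i n z) = β i.hN i.D i.hk c :=
  blkOf_coarsenY i n (by rw [hz, beta_ιK])

omit [CompleteSpace 𝔸] in
/-- the pulled-back product-form argument: `(f∘coarsen) ⊗ E = (f ⊗ E) ∘ coarsen` («λ′(x′) := λ(x)»). [cite: King1986, p.664; Balaban1985BackgroundPropagators, (3.39) p.397] -/
theorem liftY_coarsenY (f : SiteY i → ℝ) (E : 𝔸) (z : SiteY (refineK i n)) :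
    liftY (fun w => f (coarsenY i n w)) E z = liftY f E (coarsenY i n z) := rfl

end Carriers

/-! ## §2 The pointwise (3.42) letters, the two-member difference entries and the pair reader `kernelFamilyS₂` -/

section Reader

variable (j : KIdx d ℓ hd hL b₀ b₁)

/-- **THE POINTWISE (3.42) LETTER VECTOR** of a site letter `O` at `(U, Λ)`: `m = 0: (OΛ)(z)`, `1: (∇_{U,μ}OΛ)(z)`, `2: (O∇*_{U,μ}Λ)(z)`, `3: (Δ_U OΛ)(z)`
(entries 0 and 3 constant in the direction slot `μ`); their block sups are `eLatS`. [cite: Balaban1985BackgroundPropagators, (3.42) p.397] -/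
def eValS (O : SiteOpY 𝔸 j) (U : CfgY 𝔸 j) (Λ : SiteY j → 𝔸) : Fin 4 → Fin (d + 1) → SiteY j → 𝔸 :=
  ![fun _ => O U Λ, fun μ => cdS j U μ (O U Λ), fun μ => O U (cdsS j U μ Λ), fun _ => lapS j U (O U Λ)]

/-- entry 0 of `eValS`. [cite: Balaban1985BackgroundPropagators, (3.42) p.397 (first member)] -/
@[simp] theorem eValS_zero (O : SiteOpY 𝔸 j) (U : CfgY 𝔸 j) (Λ : SiteY j → 𝔸) (μ : Fin (d + 1)) : eValS j O U Λ 0 μ = O U Λ := rfl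
/-- entry 1 of `eValS`. [cite: Balaban1985BackgroundPropagators, (3.42) p.397 (second member)] -/
@[simp] theorem eValS_one (O : SiteOpY 𝔸 j) (U : CfgY 𝔸 j) (Λ : SiteY j → 𝔸) (μ : Fin (d + 1)) : eValS j O U Λ 1 μ = cdS j U μ (O U Λ) := rfl
/-- entry 2 of `eValS`. [cite: Balaban1985BackgroundPropagators, (3.42) p.397 (third member)] -/
@[simp] theorem eValS_two (O : SiteOpY 𝔸 j) (U : CfgY 𝔸 j) (Λ : SiteY j → 𝔸) (μ : Fin (d + 1)) : eValS j O U Λ 2 μ = O U (cdsS j U μ Λ) := rfl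
/-- entry 3 of `eValS`. [cite: Balaban1985BackgroundPropagators, (3.42) p.397 (fourth member)] -/
@[simp] theorem eValS_three (O : SiteOpY 𝔸 j) (U : CfgY 𝔸 j) (Λ : SiteY j → 𝔸) (μ : Fin (d + 1)) : eValS j O U Λ 3 μ = lapS j U (O U Λ) := rfl

variable (i : KIdx d ℓ hd hL b₀ b₁) (n : ℕ)

/-- **THE TWO-MEMBER DIFFERENCE ENTRIES** at `(Λ′, Λ)` on a fine block `Δ′`: `m ↦ sup_{x′ ∈ Δ′, μ} ‖η′^{e_m}·eValS⁺_m(x′) − η^{e_m}·eValS_m(x)‖`, `x = coarsen x′`,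
`e = (2, 1, 1, 0)` (lattice letters normalised to physical units member by member). [cite: King1986, p.664 (convention), Prop. 3.9 (3.73) p.665 (shape); Balaban1985BackgroundPropagators, (3.42) p.397] -/
def eDiffS (Of : SiteOpY 𝔸 (refineK i n)) (Oc : SiteOpY 𝔸 i) (U' : CfgY 𝔸 (refineK i n)) (U : CfgY 𝔸 i)
    (Λ' : SiteY (refineK i n) → 𝔸) (Λ : SiteY i → 𝔸) (s' : BlkY (refineK i n)) : Fin 4 → ℝ := fun m =>
  supBlkS' (refineK i n) s' (fun μ z =>
    (((etaS (refineK i n) ^ epow m : ℝ) : ℂ)) • eValS (refineK i n) Of U' Λ' m μ z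
      - (((etaS i ^ epow m : ℝ) : ℂ)) • eValS i Oc U Λ m μ (coarsenY i n z))

/-- the difference entries are `≥ 0`. [cite: Balaban1985BackgroundPropagators, (3.42) p.397, bookkeeping] -/
theorem eDiffS_nonneg (Of : SiteOpY 𝔸 (refineK i n)) (Oc : SiteOpY 𝔸 i) (U' : CfgY 𝔸 (refineK i n)) (U : CfgY 𝔸 i)
    (Λ' : SiteY (refineK i n) → 𝔸) (Λ : SiteY i → 𝔸) (s' : BlkY (refineK i n)) (m : Fin 4) : 0 ≤ eDiffS i n Of Oc U' U Λ' Λ s' m :=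
  supBlkS'_nonneg _ _ _

open Classical in
/-- ★ **`kernelFamilyS₂` — THE TWO-MEMBER (3.42) DIFFERENCE READER** on NODE 00's COARSE geometry `geo9K i` and FINE backgrounds `B` (run B's configuration
`cfgf`, run A's `cfgc` — the n-fold average at the record): `e m U′ (.inl f) y = sup_{‖E‖ ≤ 1} eDiffS … ((f∘coarsen) ⊗ E) (f ⊗ E) Δ⁺(ι y) m`, `0` on `.inr`;
`h1 ∕ e4 ∕ h2 ∕ l2 ∕ glob := 0` (no η-rate shape downstream).  The documented intention of `T4EtaRate.PairedInstance` for the `Kop` slot of N15's objects.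
[cite: King1986, p.664 (convention before Prop. 3.8), Prop. 3.9 (3.73) p.665; Balaban1985BackgroundPropagators, (3.42) p.397, Thm 3.14 pp.426–427 (template)] -/
def kernelFamilyS₂ (B : B9.Backgrounds) (cfgf : B.Cfg → CfgY 𝔸 (refineK i n)) (cfgc : B.Cfg → CfgY 𝔸 i)
    (Of : SiteOpY 𝔸 (refineK i n)) (Oc : SiteOpY 𝔸 i) : B9.KernelFamily (geo9K i) B where
  e := fun m U' lam c => match lam with
    | .inl f => ⨆ E : BallY 𝔸, eDiffS i n Of Oc (cfgf U') (cfgc U') (liftY (fun z => f (coarsenY i n z)) (E : 𝔸)) (liftY f (E : 𝔸))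
        (β (refineK i n).hN (refineK i n).D (refineK i n).hk (ιK i n c)) m
    | .inr _ => 0
  h1 := fun _ _ _ _ => 0
  e4 := fun _ _ _ => 0
  h2 := fun _ _ _ _ => 0
  l2 := fun _ _ _ _ => 0
  glob := fun _ _ _ _ => 0

variable {i n} {B : B9.Backgrounds} (cfgf : B.Cfg → CfgY 𝔸 (refineK i n)) (cfgc : B.Cfg → CfgY 𝔸 i)
  (Of : SiteOpY 𝔸 (refineK i n)) (Oc : SiteOpY 𝔸 i)

/-- the ON entry. [cite: King1986, p.664; Balaban1985BackgroundPropagators, (3.42) p.397] -/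
theorem kernelFamilyS₂_e_inl (m : Fin 4) (U' : B.Cfg) (f : SiteY i → ℝ) (c : IBondY i) :
    (kernelFamilyS₂ i n B cfgf cfgc Of Oc).e m U' (Sum.inl f) c =
      ⨆ E : BallY 𝔸, eDiffS i n Of Oc (cfgf U') (cfgc U') (liftY (fun z => f (coarsenY i n z)) (E : 𝔸)) (liftY f (E : 𝔸))
        (β (refineK i n).hN (refineK i n).D (refineK i n).hk (ιK i n c)) m := rfl

/-- the OFF entry (bond-sector arguments). [cite: Balaban1985BackgroundPropagators, (3.41) p.397, bookkeeping] -/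
theorem kernelFamilyS₂_e_inr (m : Fin 4) (U' : B.Cfg) (J : PBond (PV d ℓ i.m i.K hd hL) 0 → ℝ) (c : IBondY i) :
    (kernelFamilyS₂ i n B cfgf cfgc Of Oc).e m U' (Sum.inr J) c = 0 := rfl

/-- no η-rate shape for (3.43). [cite: Balaban1985BackgroundPropagators, (3.43) p.398, bookkeeping] -/
theorem kernelFamilyS₂_h1 (U' : B.Cfg) (lam : (geo9K i).Loc) (α : ℝ) (ζ : (geo9K i).Cut) : (kernelFamilyS₂ i n B cfgf cfgc Of Oc).h1 U' lam α ζ = 0 := rfl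
/-- no η-rate shape for (3.44). [cite: Balaban1985BackgroundPropagators, (3.44) p.398, bookkeeping] -/
theorem kernelFamilyS₂_e4 (U' : B.Cfg) (lam : (geo9K i).Loc) (c : IBondY i) : (kernelFamilyS₂ i n B cfgf cfgc Of Oc).e4 U' lam c = 0 := rfl
/-- no η-rate shape for (3.45). [cite: Balaban1985BackgroundPropagators, (3.45) p.398, bookkeeping] -/
theorem kernelFamilyS₂_h2 (U' : B.Cfg) (lam : (geo9K i).Loc) (α : ℝ) (ζ : (geo9K i).Cut) : (kernelFamilyS₂ i n B cfgf cfgc Of Oc).h2 U' lam α ζ = 0 := rfl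
/-- no η-rate shape for (3.46). [cite: Balaban1985BackgroundPropagators, (3.46) p.398, bookkeeping] -/
theorem kernelFamilyS₂_l2 (m : Fin 6) (U' : B.Cfg) (lam : (geo9K i).Loc) (h : (geo9K i).Cut) : (kernelFamilyS₂ i n B cfgf cfgc Of Oc).l2 m U' lam h = 0 := rfl
/-- no η-rate shape for (3.47). [cite: Balaban1985BackgroundPropagators, (3.47) p.398, bookkeeping] -/
theorem kernelFamilyS₂_glob (m : Fin 4) (U' : B.Cfg) (lam : (geo9K i).Loc) (γ : ℝ) : (kernelFamilyS₂ i n B cfgf cfgc Of Oc).glob m U' lam γ = 0 := rfl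

/-- the pair reader's entries are `≥ 0`. [cite: Balaban1985BackgroundPropagators, (3.42) p.397, bookkeeping] -/
theorem kernelFamilyS₂_e_nonneg (m : Fin 4) (U' : B.Cfg) (lam : (geo9K i).Loc) (c : IBondY i) :
    0 ≤ (kernelFamilyS₂ i n B cfgf cfgc Of Oc).e m U' lam c := by
  cases lam with
  | inl f => exact Real.iSup_nonneg fun E => eDiffS_nonneg i n Of Oc _ _ _ _ _ m
  | inr J => exact le_rfl

/-! ### §2 READ: the four READ lemmas as one letter-vector bound; the triangle inequality for the difference entries -/

variable {ι : Type} [Fintype ι] (b : Module.Basis ι ℝ 𝔸)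

/-- **def-Y's four READ lemmas as ONE bound on the letter vector**: `EBlock (kernelFamilyS j …) B₀ δ U₁` ⟹ for `‖E‖ ≤ 1`, `supp f ⊂ Δ(y′)`, `z ∈ Δ(y)` and every
`m, μ`: `η^{e_m}‖eValS_m(f ⊗ E)(z)‖ ≤ B₀·pref4(ℓ(y))_m·e^{−δd(y,y′)}·|f|`. [cite: Balaban1985BackgroundPropagators, (3.42) p.397] -/
theorem eValS_bound_of_eBlock (cfg : B.Cfg → CfgY 𝔸 j) (O : SiteOpY 𝔸 j) (par : SiteParY 𝔸 j) {B₀ δ : ℝ} {U₁ : B.Cfg}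
    (hE : EBlock (kernelFamilyS j B cfg O par) B₀ δ U₁)
    {M₂ : ℝ} (hM₂ : 0 ≤ M₂) (hrepr : ∀ (v : 𝔸) (q : ι), |b.repr v q| ≤ M₂ * ‖v‖)
    (f : SiteY j → ℝ) (y y' : IBondY j) (hs : (geo9K j).suppIn (Sum.inl f) y') {E : 𝔸} (hE1 : ‖E‖ ≤ 1)
    (m : Fin 4) (μ : Fin (d + 1)) {z : SiteY j} (hz : blkOf j.D.toDomains z = β j.hN j.D j.hk y) :
    etaS j ^ epow m * ‖eValS j O (cfg U₁) (liftY f E) m μ z‖ ≤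
      B₀ * B9.pref4 ((geo9K j).len y) m * Real.exp (-(δ * (geo9K j).dist y y')) * (geo9K j).supNorm (Sum.inl f) := by
  fin_cases m
  · simpa [epow, B9.pref4] using sq_eta_mul_norm_le_of_eBlock j b cfg O par hE hM₂ hrepr f y y' hs hE1 hz
  · simpa [epow, B9.pref4] using eta_mul_norm_cdS_le_of_eBlock j b cfg O par hE hM₂ hrepr f y y' hs hE1 μ hz
  · simpa [epow, B9.pref4] using eta_mul_norm_cdsS_le_of_eBlock j b cfg O par hE hM₂ hrepr f y y' hs hE1 μ hz
  · simpa [epow, B9.pref4] using norm_lapS_le_of_eBlock j b cfg O par hE hM₂ hrepr f y y' hs hE1 hz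

omit [Fintype ι] in
/-- ★ **THE TRIANGLE INEQUALITY FOR THE DIFFERENCE ENTRIES**: pointwise bounds `η′^{e_m}‖eValS⁺_m(x′)‖ ≤ M₁ m` on the refined copy `ιB Δ` of a block and
`η^{e_m}‖eValS_m(x)‖ ≤ M₂ m` on `Δ` give `eDiffS … (ιB Δ) m ≤ M₁ m + M₂ m` — the η-difference is at most the sum (NO η-gain; the gain is N15's content).
[cite: King1986, Prop. 3.9 (3.73) p.665 (what is NOT claimed); Balaban1985BackgroundPropagators, (3.42) p.397] -/
theorem eDiffS_le_of_pointwise (U' : CfgY 𝔸 (refineK i n)) (U : CfgY 𝔸 i) (Λ' : SiteY (refineK i n) → 𝔸) (Λ : SiteY i → 𝔸)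
    (s : BlkY i) {M₁ M₂ : Fin 4 → ℝ} (hM₁ : ∀ m, 0 ≤ M₁ m) (hM₂ : ∀ m, 0 ≤ M₂ m)
    (h₁ : ∀ (m : Fin 4) (μ : Fin (d + 1)) (z : SiteY (refineK i n)), blkOf (refineK i n).D.toDomains z = ιB i.D n s →
      etaS (refineK i n) ^ epow m * ‖eValS (refineK i n) Of U' Λ' m μ z‖ ≤ M₁ m)
    (h₂ : ∀ (m : Fin 4) (μ : Fin (d + 1)) (w : SiteY i), blkOf i.D.toDomains w = s →
      etaS i ^ epow m * ‖eValS i Oc U Λ m μ w‖ ≤ M₂ m)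
    (m : Fin 4) : eDiffS i n Of Oc U' U Λ' Λ (ιB i.D n s) m ≤ M₁ m + M₂ m := by
  refine supBlkS'_le _ _ _ (add_nonneg (hM₁ m) (hM₂ m)) fun z μ hz => ?_
  refine (norm_sub_le _ _).trans (add_le_add ?_ ?_)
  · rw [norm_smul, Complex.norm_real, Real.norm_eq_abs, abs_of_nonneg (pow_nonneg (etaS_pos _).le _)]
    exact h₁ m μ z hz
  · rw [norm_smul, Complex.norm_real, Real.norm_eq_abs, abs_of_nonneg (pow_nonneg (etaS_pos _).le _)]
    exact h₂ m μ _ (blkOf_coarsenY i n hz)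

omit [Fintype ι] in
/-- ★ the same on the carrier blocks of an observation site `y` and its embedding `ι y` (`Δ⁺(ι y) = ιB Δ(y)`): pointwise bounds on `Δ⁺(ι y)` at the fine
member and on `Δ(y)` at the coarse member bound the difference entry on `Δ⁺(ι y)` by their sum. [cite: King1986, p.664, Prop. 3.9 (3.73) p.665 (what is NOT claimed); Balaban1985BackgroundPropagators, (3.42) p.397] -/
theorem eDiffS_le_of_pointwise_beta (U' : CfgY 𝔸 (refineK i n)) (U : CfgY 𝔸 i) (Λ' : SiteY (refineK i n) → 𝔸) (Λ : SiteY i → 𝔸)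
    (c : IBondY i) {M₁ M₂ : Fin 4 → ℝ} (hM₁ : ∀ m, 0 ≤ M₁ m) (hM₂ : ∀ m, 0 ≤ M₂ m)
    (h₁ : ∀ (m : Fin 4) (μ : Fin (d + 1)) (z : SiteY (refineK i n)),
      blkOf (refineK i n).D.toDomains z = β (refineK i n).hN (refineK i n).D (refineK i n).hk (ιK i n c) →
      etaS (refineK i n) ^ epow m * ‖eValS (refineK i n) Of U' Λ' m μ z‖ ≤ M₁ m)
    (h₂ : ∀ (m : Fin 4) (μ : Fin (d + 1)) (w : SiteY i), blkOf i.D.toDomains w = β i.hN i.D i.hk c →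
      etaS i ^ epow m * ‖eValS i Oc U Λ m μ w‖ ≤ M₂ m)
    (m : Fin 4) : eDiffS i n Of Oc U' U Λ' Λ (β (refineK i n).hN (refineK i n).D (refineK i n).hk (ιK i n c)) m ≤ M₁ m + M₂ m := by
  refine supBlkS'_le _ _ _ (add_nonneg (hM₁ m) (hM₂ m)) fun z μ hz => ?_
  refine (norm_sub_le _ _).trans (add_le_add ?_ ?_)
  · rw [norm_smul, Complex.norm_real, Real.norm_eq_abs, abs_of_nonneg (pow_nonneg (etaS_pos _).le _)]
    exact h₁ m μ z hz
  · rw [norm_smul, Complex.norm_real, Real.norm_eq_abs, abs_of_nonneg (pow_nonneg (etaS_pos _).le _)]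
    exact h₂ m μ _ (blkOf_coarsenY_of_beta i n hz)

end Reader

/-! ## §3 At a member of record: King's pairing `pairingY`, the paired instance, the pair reader `kernelFamilyS₂Y`, and (3.42)+(3.42) ⟹ the `γ = 0` η-rate block -/

section Member

variable (𝔸) (G : Subgroup 𝔸ˣ) (x : MemberY d ℓ hd hL b₀ b₁ Mstar) (n : ℕ)

/-- ★ **KING'S PAIRING OF THE MEMBER OF RECORD `x` WITH ITS n-FOLD REFINEMENT `x⁺ = refineY x n`** («run A at η, run B at η′ = L^{−n}η»): MODULE A's type-level
fields BY NAME, the argument transport `τ := τPull` («λ′(x′) := λ(x)»), and the background transport `avg` (fine ↦ coarse, `avg 1 = 1`) as PARAMETERS —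
Bałaban's n-fold average is NOT constructed here. [cite: King1986, p.664 (convention before Prop. 3.8); Balaban1985BackgroundPropagators, Thm 3.14 pp.426–427 (template)] -/
def pairingY (avg : CfgY 𝔸 (refineY x n).toKIdx → CfgY 𝔸 x.toKIdx)
    (havg : avg (bg9Y 𝔸 G (refineY x n)).one = (bg9Y 𝔸 G x).one) :
    EtaPairing (geo9Y x) (geo9Y (refineY x n)) (bg9Y 𝔸 G x) (bg9Y 𝔸 G (refineY x n)) where
  n := n
  k_eq := k_refineY x n
  L_eq := L_refineY x n
  M_eq := M_refineY x n
  eta_eq := eta_refineY x n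
  ι := ιY x n
  scale_ι := scale_ιY x n
  dist_ι := dist_ιY x n
  τ := τPull x n
  suppIn_τ := suppIn_τPull x n
  supNorm_τ := supNorm_τPull_le x n
  avg := avg
  avg_one := havg

variable {𝔸 G x n} (avg : CfgY 𝔸 (refineY x n).toKIdx → CfgY 𝔸 x.toKIdx) (havg : avg (bg9Y 𝔸 G (refineY x n)).one = (bg9Y 𝔸 G x).one)

/-- the pairing's scale shift is `n`. [cite: King1986, p.664, dictionary] -/
@[simp] theorem pairingY_n : (pairingY 𝔸 G x n avg havg).n = n := rfl
/-- the pairing's site embedding is MODULE A's `ιY`. [cite: King1986, p.664, dictionary] -/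
@[simp] theorem pairingY_ι : (pairingY 𝔸 G x n avg havg).ι = ιY x n := rfl
/-- the pairing's argument transport is MODULE A's `τPull`. [cite: King1986, p.664, dictionary] -/
@[simp] theorem pairingY_τ : (pairingY 𝔸 G x n avg havg).τ = τPull x n := rfl
/-- the pairing's background transport is the parameter `avg`. [cite: King1986, p.664, dictionary] -/
@[simp] theorem pairingY_avg : (pairingY 𝔸 G x n avg havg).avg = avg := rfl

variable (𝔸 G x n) in
/-- ★ **THE PAIRED INSTANCE OF RECORD** `(geo9Y x, geo9Y x⁺, bg9Y x, bg9Y x⁺, pairingY)` — the `pi` slot of N15's `NE2Objects₁₁` at one member.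
[cite: King1986, p.664; Balaban1985BackgroundPropagators, Thm 3.14 pp.426–427 (typing template)] -/
def pairedInstanceY : PairedInstance :=
  ⟨geo9Y x, geo9Y (refineY x n), bg9Y 𝔸 G x, bg9Y 𝔸 G (refineY x n), pairingY 𝔸 G x n avg havg⟩

/-- the paired instance's coarse geometry. [cite: King1986, p.664, dictionary] -/
@[simp] theorem pairedInstanceY_gc : (pairedInstanceY 𝔸 G x n avg havg).gc = geo9Y x := rfl
/-- the paired instance's fine geometry. [cite: King1986, p.664, dictionary] -/
@[simp] theorem pairedInstanceY_gf : (pairedInstanceY 𝔸 G x n avg havg).gf = geo9Y (refineY x n) := rfl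
/-- the paired instance's coarse backgrounds. [cite: King1986, p.664, dictionary] -/
@[simp] theorem pairedInstanceY_Bc : (pairedInstanceY 𝔸 G x n avg havg).Bc = bg9Y 𝔸 G x := rfl
/-- the paired instance's fine backgrounds. [cite: King1986, p.664, dictionary] -/
@[simp] theorem pairedInstanceY_Bf : (pairedInstanceY 𝔸 G x n avg havg).Bf = bg9Y 𝔸 G (refineY x n) := rfl
/-- the paired instance's pairing. [cite: King1986, p.664, dictionary] -/
@[simp] theorem pairedInstanceY_pair : (pairedInstanceY 𝔸 G x n avg havg).pair = pairingY 𝔸 G x n avg havg := rfl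

variable (G x n) in
/-- ★ **THE TWO-MEMBER (3.42) DIFFERENCE READER OF RECORD** at the member `x`: `kernelFamilyS₂` at `i = x.toKIdx` over the FINE member's backgrounds
`bg9Y 𝔸 G x⁺`, run B's configuration the identity, run A's the parameter `avg`; letters `Of ∕ Oc` at the fine ∕ coarse member (record default `GpY _ (parSymY _)` twice).
The `Kop` slot of N15's `NE2Objects₁₁` at one member. [cite: King1986, p.664, Prop. 3.9 (3.73) p.665; Balaban1985BackgroundPropagators, (3.42) p.397, Thm 3.14 pp.426–427] -/
def kernelFamilyS₂Y (Of : SiteOpY 𝔸 (refineY x n).toKIdx) (Oc : SiteOpY 𝔸 x.toKIdx) :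
    B9.KernelFamily (geo9Y x) (bg9Y 𝔸 G (refineY x n)) :=
  kernelFamilyS₂ x.toKIdx n (bg9Y 𝔸 G (refineY x n)) (fun U => U) avg Of Oc

variable (Of : SiteOpY 𝔸 (refineY x n).toKIdx) (Oc : SiteOpY 𝔸 x.toKIdx)

/-- the ON entry of the reader of record: `⨆_{‖E‖≤1} eDiffS … ((f∘coarsen) ⊗ E) (f ⊗ E) Δ⁺(ιY y) m` at `(U′, avg U′)`. [cite: King1986, p.664; Balaban1985BackgroundPropagators, (3.42) p.397] -/
theorem kernelFamilyS₂Y_e_inl (m : Fin 4) (U' : CfgY 𝔸 (refineY x n).toKIdx) (f : SiteY x.toKIdx → ℝ) (c : (geo9Y x).Site) :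
    (kernelFamilyS₂Y G x n avg Of Oc).e m U' (Sum.inl f) c =
      ⨆ E : BallY 𝔸, eDiffS x.toKIdx n Of Oc U' (avg U') (liftY (fun z => f (coarsenY x.toKIdx n z)) (E : 𝔸)) (liftY f (E : 𝔸))
        (β (refineY x n).hN (refineY x n).D (refineY x n).hk (ιY x n c)) m := rfl

/-- the OFF entry of the reader of record. [cite: Balaban1985BackgroundPropagators, (3.41) p.397, bookkeeping] -/
theorem kernelFamilyS₂Y_e_inr (m : Fin 4) (U' : CfgY 𝔸 (refineY x n).toKIdx) (J : PBond (PV d ℓ x.m x.K hd hL) 0 → ℝ) (c : (geo9Y x).Site) :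
    (kernelFamilyS₂Y G x n avg Of Oc).e m U' (Sum.inr J) c = 0 := rfl

/-- **`EtaRateIneq342` AT RATE EXPONENT `γ = 0` IS THE (3.42) BLOCK `EBlock`** (the rate factor `(η/ℓ(y))⁰ = 1`). [cite: King1986, Prop. 3.9 (3.73) p.665; Balaban1985BackgroundPropagators, (3.42) p.397] -/
theorem etaRateIneq342_zero_iff {g : B9.Geometry} {B' : B9.Backgrounds} (K : B9.KernelFamily g B') (B₀ δ₀ : ℝ) (U : B'.Cfg) :
    EtaRateIneq342 K B₀ δ₀ 0 U ↔ EBlock K B₀ δ₀ U := by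
  simp only [EtaRateIneq342, EBlock, rateFactor, Real.rpow_zero, max_self, mul_one]

variable {ι : Type} [Fintype ι] (b : Module.Basis ι ℝ 𝔸)

/-- ★★ **(3.42) AT THE FINE MEMBER + (3.42) AT THE COARSE MEMBER ⟹ THE (3.42) BLOCK OF THE PAIR READER WITH THE SUM OF THE CONSTANTS** (same rate `δ`):
[B9] Thm 3.1 twice, MODULE A's `Δ⁺(ι y) = ιB Δ(y)`, `ℓ⁺(ι y) = ℓ(y)`, `d⁺(ι y, ι y′) = d(y, y′)`, `|τλ| ≤ |λ|`, and the triangle inequality — the honest floor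
of N15's η-rate (NO gain in η). [cite: Balaban1985BackgroundPropagators, Thm 3.1 (3.42) p.397; King1986, p.664, Prop. 3.9 (3.73) p.665 (what is NOT claimed)] -/
theorem eBlock_kernelFamilyS₂Y_of_eBlock (parf : SiteParY 𝔸 (refineY x n).toKIdx) (parc : SiteParY 𝔸 x.toKIdx)
    {M₂ : ℝ} (hM₂ : 0 ≤ M₂) (hrepr : ∀ (v : 𝔸) (q : ι), |b.repr v q| ≤ M₂ * ‖v‖)
    {B₁ B₂ δ : ℝ} (hB₁ : 0 ≤ B₁) (hB₂ : 0 ≤ B₂) {U' : CfgY 𝔸 (refineY x n).toKIdx}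
    (hf : EBlock (kernelFamilyS (refineY x n).toKIdx (bg9Y 𝔸 G (refineY x n)) (fun U => U) Of parf) B₁ δ U')
    (hc : EBlock (kernelFamilyS x.toKIdx (bg9Y 𝔸 G (refineY x n)) avg Oc parc) B₂ δ U') :
    EBlock (kernelFamilyS₂Y G x n avg Of Oc) (B₁ + B₂) δ U' := by
  intro m lam y y' hs
  have hlen : 0 ≤ (geo9Y x).len y := (B6KLevelCensusIndexV1.len_pos x.toKIdx y).le
  have hR : 0 ≤ (B₁ + B₂) * B9.pref4 ((geo9Y x).len y) m * Real.exp (-(δ * (geo9Y x).dist y y')) * (geo9Y x).supNorm lam :=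
    mul_nonneg (mul_nonneg (mul_nonneg (add_nonneg hB₁ hB₂) (pref4_nonneg _ hlen m)) (Real.exp_pos _).le) (geo9K_supNorm_nonneg x.toKIdx lam)
  cases lam with
  | inr J => exact hR
  | inl f =>
    rw [kernelFamilyS₂Y_e_inl]
    refine Real.iSup_le (fun E => ?_) hR
    have hE1 : ‖(E : 𝔸)‖ ≤ 1 := mem_closedBall_zero_iff.1 E.2
    have hS : 0 ≤ (geo9Y x).supNorm (Sum.inl f) := geo9K_supNorm_nonneg x.toKIdx (Sum.inl f)
    -- the pulled-back argument is supported in `Δ⁺(ι y′)` (MODULE A)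
    have hs' : (geo9K (refineY x n).toKIdx).suppIn (Sum.inl fun z => f (coarsenY x.toKIdx n z)) (ιY x n y') :=
      suppIn_τPull x n (Sum.inl f) y' hs
    -- the triangle inequality on `Δ⁺(ι y) = ιB Δ(y)` with the two READ bound vectors
    have key := eDiffS_le_of_pointwise_beta (i := x.toKIdx) (n := n) Of Oc U' (avg U')
      (liftY (fun z => f (coarsenY x.toKIdx n z)) (E : 𝔸)) (liftY f (E : 𝔸)) y
      (M₁ := fun k => B₁ * B9.pref4 ((geo9Y x).len y) k * Real.exp (-(δ * (geo9Y x).dist y y')) * (geo9Y x).supNorm (Sum.inl f))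
      (M₂ := fun k => B₂ * B9.pref4 ((geo9Y x).len y) k * Real.exp (-(δ * (geo9Y x).dist y y')) * (geo9Y x).supNorm (Sum.inl f))
      (fun k => mul_nonneg (mul_nonneg (mul_nonneg hB₁ (pref4_nonneg _ hlen k)) (Real.exp_pos _).le) hS)
      (fun k => mul_nonneg (mul_nonneg (mul_nonneg hB₂ (pref4_nonneg _ hlen k)) (Real.exp_pos _).le) hS)
      ?_ ?_ m
    · refine key.trans (le_of_eq ?_)
      ring
    · -- fine member: READ at `(ι y, ι y′)` with the pulled-back argument, then `ℓ⁺(ι y) = ℓ(y)`, `d⁺(ι y, ι y′) = d(y, y′)`, `|τλ| ≤ |λ|`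
      intro k μ z hz
      have h := eValS_bound_of_eBlock (B := bg9Y 𝔸 G (refineY x n)) (refineY x n).toKIdx b (fun U => U) Of parf hf hM₂ hrepr
        (fun z => f (coarsenY x.toKIdx n z)) (ιY x n y) (ιY x n y') hs' hE1 k μ hz
      have hl : (geo9K (refineY x n).toKIdx).len (ιY x n y) = (geo9Y x).len y := len_ιY x n y
      have hdist : (geo9K (refineY x n).toKIdx).dist (ιY x n y) (ιY x n y') = (geo9Y x).dist y y' := dist_ιY x n y y'
      have hsup : (geo9K (refineY x n).toKIdx).supNorm (Sum.inl fun z => f (coarsenY x.toKIdx n z)) ≤ (geo9Y x).supNorm (Sum.inl f) :=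
        supNorm_τPull_le x n (Sum.inl f)
      rw [hl, hdist] at h
      exact h.trans (mul_le_mul_of_nonneg_left hsup (mul_nonneg (mul_nonneg hB₁ (pref4_nonneg _ hlen k)) (Real.exp_pos _).le))
    · -- coarse member: READ at `(y, y′)` verbatim
      intro k μ w hw
      exact eValS_bound_of_eBlock (B := bg9Y 𝔸 G (refineY x n)) x.toKIdx b avg Oc parc hc hM₂ hrepr f y y' hs hE1 k μ hw

/-- ★★ the same, in N15's currency: **`EtaRateIneq342` at rate exponent `γ = 0`** for the pair reader of record from (3.42) at the two members.
[cite: King1986, Prop. 3.9 (3.73) p.665 (γ > 0 NOT claimed); Balaban1985BackgroundPropagators, Thm 3.1 (3.42) p.397] -/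
theorem etaRateIneq342_zero_kernelFamilyS₂Y (parf : SiteParY 𝔸 (refineY x n).toKIdx) (parc : SiteParY 𝔸 x.toKIdx)
    {M₂ : ℝ} (hM₂ : 0 ≤ M₂) (hrepr : ∀ (v : 𝔸) (q : ι), |b.repr v q| ≤ M₂ * ‖v‖)
    {B₁ B₂ δ : ℝ} (hB₁ : 0 ≤ B₁) (hB₂ : 0 ≤ B₂) {U' : CfgY 𝔸 (refineY x n).toKIdx}
    (hf : EBlock (kernelFamilyS (refineY x n).toKIdx (bg9Y 𝔸 G (refineY x n)) (fun U => U) Of parf) B₁ δ U')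
    (hc : EBlock (kernelFamilyS x.toKIdx (bg9Y 𝔸 G (refineY x n)) avg Oc parc) B₂ δ U') :
    EtaRateIneq342 (kernelFamilyS₂Y G x n avg Of Oc) (B₁ + B₂) δ 0 U' :=
  (etaRateIneq342_zero_iff _ _ _ _).2 (eBlock_kernelFamilyS₂Y_of_eBlock avg Of Oc b parf parc hM₂ hrepr hB₁ hB₂ hf hc)

end Member

end

end Literature.MathematicalPhysics.QuantumFieldTheory.Balaban1983to89.Node00.OpsYRead342Pair
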